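import Summits.QuantumFields.YangMills.Theorems.ContractibleFibreFibreToTorusEnergyUniqueDensity
import Summits.QuantumFields.YangMills.Theorems.ContractibleFibreFibreToTorusEnergyConvexity
import Summits.QuantumFields.YangMills.Theorems.ContractibleFibreFibreToTorusConvexCountableNondiff
import HarnessLib

/-!
# Outside a countable set of couplings, all translation-invariant lattice Yang–Mills Gibbs states have one action density

Helper file of crux `FibreToTorus` (stmt-QuantumFields-16244), line `Sketch` (energy programme E7): the torus pressure
`f = freeEnergyDensity 4 ρ` is convex (`energy_convexOn_freeEnergyDensity`), hence differentiable outside a countable set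
(`convexOn_univ_countable_not_differentiableAt`), and at every differentiability point all translation-invariant DLR states
of the Wilson specification have the same expectation of the curvature species `actionDensity ρ`
(`energy_uniqueActionDensity_of_differentiableAt`).  So the ENERGY SECTOR of weak-coupling translation-invariant uniqueness
(stub U_tr / its tangent reshape PTU + Bridge of line `Sketch`) holds unconditionally at all but countably many couplings
(Friedli–Velenik 2017, Prop. 6.91 with Thm. 6.92 and the countability of kinks of a convex function).
-/

noncomputable section

open MeasureTheory Set
open Literature.MathematicalPhysics.QuantumLattice (LGConfig ymGibbsMeasures IsZdTranslationInvariant freeEnergyDensity)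
open Literature.MathematicalPhysics.QuantumFieldTheory (actionDensity)

namespace Summit.QuantumFields.YangMills.Theorems.FibreToTorus

/-- **Energy-sector uniqueness off a countable set of couplings** (registered helper sub-goal
`energy_uniqueActionDensity_off_countable`): for the four-dimensional Wilson lattice gauge theory of a compact Hausdorff
second-countable group in a continuous matrix representation `ρ` there is a countable set `S ⊆ ℝ` such that at every
coupling `β ∉ S` any two translation-invariant DLR states have the same mean action density `∫ actionDensity ρ`.
[cite: FriedliVelenik2017, Prop. 6.91] -/
theorem energy_uniqueActionDensity_off_countable : ∀ (N : ℕ) (G : Type) [Group G] [TopologicalSpace G] [IsTopologicalGroup G] [CompactSpace G] [MeasurableSpace G] [BorelSpace G] [SecondCountableTopology G] [T2Space G] (ρ : G →* Matrix (Fin N) (Fin N) ℂ), Continuous ρ → ∃ S : Set ℝ, S.Countable ∧ ∀ β : ℝ, β ∉ S → ∀ μ ν : MeasureTheory.Measure (LGConfig 4 G), μ ∈ ymGibbsMeasures (d := 4) ρ β → ν ∈ ymGibbsMeasures (d := 4) ρ β → IsZdTranslationInvariant μ → IsZdTranslationInvariant ν → ∫ U, actionDensity ρ U ∂μ = ∫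 U, actionDensity ρ U ∂ν := by
  intro N G _ _ _ _ _ _ _ _ ρ hρ
  refine ⟨{β : ℝ | ¬ DifferentiableAt ℝ (freeEnergyDensity 4 ρ) β},
    convexOn_univ_countable_not_differentiableAt _ (energy_convexOn_freeEnergyDensity 4 N G ρ hρ), ?_⟩
  intro β hβ μ ν hμ hν hμT hνT
  have hdiff : DifferentiableAt ℝ (freeEnergyDensity 4 ρ) β := by
    by_contra h
    exact hβ h
  exact energy_uniqueActionDensity_of_differentiableAt N G ρ hρ β hdiff μ ν hμ hν hμT hνT

end Summit.QuantumFields.YangMills.Theorems.FibreToTorus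

end
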